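import Literature.Geometry.DiscreteGeometry.ShellCensusReplay
import Literature.Analysis.ValidatedNumerics.QuadCertText
import Literature.Analysis.FluidPDE.VectorCalculus
import HarnessLib

/-!
# Tolerant shells as a `QuadCert` problem: the root context and the goal specifications

Topic `Literature/Geometry/DiscreteGeometry`.  The problem layer between the generic degree-two certificate
checker `Literature.Analysis.ValidatedNumerics.QuadCert` (`QuadCertTree.lean`) and TOLERANT RIGIDITY statements for a
labelled shell `t : Fin n → ℝ³` — every point at distance `∈ [rlo, rhi]` from the origin, prescribed pairs
(bonds) at distance `∈ [rlo, rhi]`, prescribed pairs (far pairs) at distance `≥ gap`, in the frame of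
`ShellCensus.exists_frame` — whose conclusion is closeness, after a linear isometry, to a pattern with rational
anchors (the model computer classification of Musin–Tarasov [cite: MusinTarasov2012, §4], here in
Positivstellensatz-certificate form [cite: Lasserre2001, Thm 4.2]):

* `ShellSpec` (the rational data), `sqNormP` / `sqDistP` (`‖x_k‖²`, `‖x_k − x_l‖²` as `QPoly`s in the flat
  coordinates `ShellCensus.flat t`), **`rootCtx`** (the hypotheses as a `QuadCert.Ctx`, in a FIXED ORDER that certificate
  generators must reproduce: radius windows, bond windows, far gaps, frame signs; frame zeros as equations) and
  **`rootCtx_holds`**;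
* `Goal` — a goal specification: an exactly orthogonal rational matrix `M` (`ShellCensus.matOrthoB`), an affine
  ROTATION FIELD `ω(x) = (ω₀(x), ω₁(x), ω₂(x))` (three affine `QPoly`s), and rationals `θ`, `ε`; its goal polynomials
  `gp P g = [θ² − ‖ω‖², ((η − ε − aeps)² − ‖x_k − q_k − ω × q_k‖²)_{k<n}]` with `q_k = M · anchor_k`, guarded by the
  well-formedness test `Goal.ok` (in particular `(θ²/2 + θ³/4)(1 + aeps) ≤ ε`);
* **`goal_sound`**: the goal facts at `flat t` give `‖ω‖ ≤ θ` and `‖t_k − q_k − ω × q_k‖ ≤ η − ε − aeps` for every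
  `k` — the input of the small-rotation (Rodrigues remainder) argument that produces the isometry.

Everything here is bookkeeping over `ℚ` plus the two soundness lemmas; no facts, no axioms.  First user: the
metric half of crux `ShellTrichotomy` (`Summits/AtomisticToContinuum/Crystallization`, fcc / hcp kissing shells at
tolerance `1/50`, gap `63/50`, `η = 1/5`).

## References
* O. R. Musin, A. S. Tarasov, *The strong thirteen spheres problem*, DCG 48 (2012), §4. [cite: MusinTarasov2012, §4]
* J. B. Lasserre, SIAM J. Optim. 11 (2001), Thm 4.2. [cite: Lasserre2001, Thm 4.2]
-/

noncomputable section

namespace Literature.Geometry.DiscreteGeometry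

open Literature.Analysis.ValidatedNumerics Literature.Analysis.ValidatedNumerics.QPoly
  Literature.Analysis.ValidatedNumerics.QuadCert ShellCensus

/-- Euclidean `3`-space. -/
local notation "E3" => EuclideanSpace ℝ (Fin 3)

namespace ShellQuadCert

/-! ### Squared norms and distances as polynomials in the flat coordinates -/

/-- `‖x_k‖²` (variables `3k, 3k+1, 3k+2`). [folklore] -/
def sqNormP (k : ℕ) : QPoly :=
  ⟨0, [], [(3 * k, 3 * k, 1), (3 * k + 1, 3 * k + 1, 1), (3 * k + 2, 3 * k + 2, 1)]⟩

/-- `‖x_k − x_l‖²`. [folklore] -/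
def sqDistP (k l : ℕ) : QPoly :=
  ⟨0, [], [(3 * k, 3 * k, 1), (3 * l, 3 * l, 1), (3 * k, 3 * l, -2),
    (3 * k + 1, 3 * k + 1, 1), (3 * l + 1, 3 * l + 1, 1), (3 * k + 1, 3 * l + 1, -2),
    (3 * k + 2, 3 * k + 2, 1), (3 * l + 2, 3 * l + 2, 1), (3 * k + 2, 3 * l + 2, -2)]⟩

variable {n : ℕ}

/-- `flat t` at the three coordinates of point `k`. [folklore] -/
theorem flat_coord (t : Fin n → E3) (k : Fin n) :
    flat t (3 * k) = t k 0 ∧ flat t (3 * k + 1) = t k 1 ∧ flat t (3 * k + 2) = t k 2 := by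
  refine ⟨?_, ?_, ?_⟩
  · simpa using flat_apply t k 0
  · simpa using flat_apply t k 1
  · simpa using flat_apply t k 2

/-- `sqNormP` evaluates to `‖t k‖²`. [folklore] -/
theorem eval_sqNormP (t : Fin n → E3) (k : Fin n) : (sqNormP k).eval (flat t) = ‖t k‖ ^ 2 := by
  obtain ⟨h0, h1, h2⟩ := flat_coord t k
  rw [norm_sq_fin3]
  simp only [sqNormP, eval, linEval_nil, quadEval_cons, quadEval_nil, h0, h1, h2]
  push_cast; ring

/-- `sqDistP` evaluates to `dist (t k) (t l)²`. [folklore] -/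
theorem eval_sqDistP (t : Fin n → E3) (k l : Fin n) :
    (sqDistP k l).eval (flat t) = dist (t k) (t l) ^ 2 := by
  obtain ⟨h0, h1, h2⟩ := flat_coord t k
  obtain ⟨g0, g1, g2⟩ := flat_coord t l
  rw [dist_sq_fin3]
  simp only [sqDistP, eval, linEval_nil, quadEval_cons, quadEval_nil, h0, h1, h2, g0, g1, g2]
  push_cast; ring

/-! ### The problem data and the root context -/

/-- Rational data of a tolerant-shell problem: `n` points, radius / bond window `[rlo, rhi]`, far gap `gap`,
the labelled bond and far pairs, the frame indices `i0, i1, i2` (`exists_frame`), the rational anchors of the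
pattern with accuracy `aeps`, and the closeness `eta` to certify. [folklore] -/
structure ShellSpec where
  /-- number of points -/
  n : ℕ
  /-- lower window end -/
  rlo : ℚ
  /-- upper window end -/
  rhi : ℚ
  /-- far gap -/
  gap : ℚ
  /-- labelled bonds `(k, l)` -/
  bonds : List (ℕ × ℕ)
  /-- labelled far pairs `(k, l)` -/
  fars : List (ℕ × ℕ)
  /-- frame point on the `z`-axis -/
  i0 : ℕ
  /-- frame point in the `xz`-half-plane `x ≥ 0` -/
  i1 : ℕ
  /-- frame point with `y ≥ 0` -/
  i2 : ℕ
  /-- rational anchors of the pattern -/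
  anchors : List (ℚ × ℚ × ℚ)
  /-- anchor accuracy -/
  aeps : ℚ
  /-- closeness to certify -/
  eta : ℚ

namespace ShellSpec

variable (P : ShellSpec)

/-- Index sanity: all pair indices `< n`, frame indices `< n`, `n` anchors, `0 ≤ rlo`, `0 ≤ gap`. [folklore] -/
def okB : Bool :=
  P.bonds.all (fun kl => decide (kl.1 < P.n) && decide (kl.2 < P.n)) &&
    P.fars.all (fun kl => decide (kl.1 < P.n) && decide (kl.2 < P.n)) &&
    decide (P.i0 < P.n) && decide (P.i1 < P.n) && decide (P.i2 < P.n) &&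
    decide (P.anchors.length = P.n) && decide (0 ≤ P.rlo) && decide (0 ≤ P.gap)

/-- Anchor `k` (junk `0` out of range). [folklore] -/
def anchor (k : ℕ) : ℚ × ℚ × ℚ := P.anchors.getD k (0, 0, 0)

/-- The inequality facts of the root context, in the canonical order: for each point the two radius windows,
for each bond the two windows, for each far pair the gap, then the three frame signs
`x_{i0,2} ≥ 0`, `x_{i1,0} ≥ 0`, `x_{i2,1} ≥ 0`. [folklore] -/
def rootIneqs : List QPoly :=
  ((List.range P.n).flatMap fun k =>
      [sub (const (P.rhi ^ 2)) (sqNormP k), sub (sqNormP k) (const (P.rlo ^ 2))]) ++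
    (P.bonds.flatMap fun kl =>
      [sub (const (P.rhi ^ 2)) (sqDistP kl.1 kl.2), sub (sqDistP kl.1 kl.2) (const (P.rlo ^ 2))]) ++
    (P.fars.map fun kl => sub (sqDistP kl.1 kl.2) (const (P.gap ^ 2))) ++
    [var (3 * P.i0 + 2), var (3 * P.i1), var (3 * P.i2 + 1)]

/-- The equation facts of the root context: `x_{i0,0} = x_{i0,1} = x_{i1,1} = 0`. [folklore] -/
def rootEqs : List QPoly := [var (3 * P.i0), var (3 * P.i0 + 1), var (3 * P.i1 + 1)]

/-- **The root context** of a tolerant-shell certificate. [folklore] -/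
def rootCtx : Ctx := ⟨P.rootIneqs.toArray, P.rootEqs.toArray⟩

/-- The hypotheses of a tolerant-shell problem in the frame, for a tuple `t`. [folklore] -/
structure Hyp (t : Fin P.n → E3) : Prop where
  /-- radii in the window -/
  norm_mem : ∀ k, (P.rlo : ℝ) ≤ ‖t k‖ ∧ ‖t k‖ ≤ P.rhi
  /-- bonds in the window -/
  bond_mem : ∀ kl ∈ P.bonds, ∀ (hk : kl.1 < P.n) (hl : kl.2 < P.n),
    (P.rlo : ℝ) ≤ dist (t ⟨kl.1, hk⟩) (t ⟨kl.2, hl⟩) ∧ dist (t ⟨kl.1, hk⟩) (t ⟨kl.2, hl⟩) ≤ P.rhi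
  /-- far pairs beyond the gap -/
  far_ge : ∀ kl ∈ P.fars, ∀ (hk : kl.1 < P.n) (hl : kl.2 < P.n), (P.gap : ℝ) ≤ dist (t ⟨kl.1, hk⟩) (t ⟨kl.2, hl⟩)
  /-- frame: `t i0` on the nonnegative `z`-axis -/
  frame0 : ∀ h : P.i0 < P.n, t ⟨P.i0, h⟩ 0 = 0 ∧ t ⟨P.i0, h⟩ 1 = 0 ∧ 0 ≤ t ⟨P.i0, h⟩ 2
  /-- frame: `t i1` in the half-plane `y = 0 ≤ x` -/
  frame1 : ∀ h : P.i1 < P.n, t ⟨P.i1, h⟩ 1 = 0 ∧ 0 ≤ t ⟨P.i1, h⟩ 0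
  /-- frame: `t i2` in the half-space `y ≥ 0` -/
  frame2 : ∀ h : P.i2 < P.n, 0 ≤ t ⟨P.i2, h⟩ 1

/-- **The root context holds** at `flat t` under the hypotheses. [folklore] -/
theorem rootCtx_holds (hP : P.okB = true) {t : Fin P.n → E3} (H : P.Hyp t) : P.rootCtx.Holds (flat t) := by
  simp only [okB, Bool.and_eq_true, List.all_eq_true, decide_eq_true_eq] at hP
  obtain ⟨⟨⟨⟨⟨⟨⟨hb, hf⟩, hi0⟩, hi1⟩, hi2⟩, -⟩, hrlo⟩, hgap⟩ := hP
  have hrlo' : (0 : ℝ) ≤ P.rlo := by exact_mod_cast hrlo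
  have hgap' : (0 : ℝ) ≤ P.gap := by exact_mod_cast hgap
  refine ⟨fun g hg => ?_, fun h hh => ?_⟩
  · simp only [rootCtx, List.mem_toArray, rootIneqs, List.mem_append, List.mem_flatMap, List.mem_range,
      List.mem_cons, List.not_mem_nil, or_false, List.mem_map] at hg
    rcases hg with ((⟨k, hk, rfl | rfl⟩ | ⟨kl, hkl, rfl | rfl⟩) | ⟨kl, hkl, rfl⟩) | rfl | rfl | rfl
    · have := (H.norm_mem ⟨k, hk⟩).2
      have e := eval_sqNormP t ⟨k, hk⟩
      simp only at e
      rw [eval_sub, eval_const, e]; push_cast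
      nlinarith [norm_nonneg (t ⟨k, hk⟩)]
    · have := (H.norm_mem ⟨k, hk⟩).1
      have e := eval_sqNormP t ⟨k, hk⟩
      simp only at e
      rw [eval_sub, eval_const, e]; push_cast
      nlinarith
    · obtain ⟨hk, hl⟩ := hb kl hkl
      have := (H.bond_mem kl hkl hk hl).2
      have e := eval_sqDistP t ⟨kl.1, hk⟩ ⟨kl.2, hl⟩
      simp only at e
      rw [eval_sub, eval_const, e]; push_cast
      nlinarith [dist_nonneg (x := t ⟨kl.1, hk⟩) (y := t ⟨kl.2, hl⟩)]
    · obtain ⟨hk, hl⟩ := hb kl hkl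
      have := (H.bond_mem kl hkl hk hl).1
      have e := eval_sqDistP t ⟨kl.1, hk⟩ ⟨kl.2, hl⟩
      simp only at e
      rw [eval_sub, eval_const, e]; push_cast
      nlinarith
    · obtain ⟨hk, hl⟩ := hf kl hkl
      have := H.far_ge kl hkl hk hl
      have e := eval_sqDistP t ⟨kl.1, hk⟩ ⟨kl.2, hl⟩
      simp only at e
      rw [eval_sub, eval_const, e]; push_cast
      nlinarith
    · rw [eval_var]
      have := (flat_coord t ⟨P.i0, hi0⟩).2.2
      simp only at this; rw [this]; exact (H.frame0 hi0).2.2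
    · rw [eval_var]
      have := (flat_coord t ⟨P.i1, hi1⟩).1
      simp only at this; rw [this]; exact (H.frame1 hi1).2
    · rw [eval_var]
      have := (flat_coord t ⟨P.i2, hi2⟩).2.1
      simp only at this; rw [this]; exact H.frame2 hi2
  · simp only [rootCtx, List.mem_toArray, rootEqs, List.mem_cons, List.not_mem_nil, or_false] at hh
    rcases hh with rfl | rfl | rfl
    · rw [eval_var]
      have := (flat_coord t ⟨P.i0, hi0⟩).1
      simp only at this; rw [this]; exact (H.frame0 hi0).1
    · rw [eval_var]
      have := (flat_coord t ⟨P.i0, hi0⟩).2.1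
      simp only at this; rw [this]; exact (H.frame0 hi0).2.1
    · rw [eval_var]
      have := (flat_coord t ⟨P.i1, hi1⟩).2.1
      simp only at this; rw [this]; exact (H.frame1 hi1).1

end ShellSpec

/-! ### Goal specifications: a rational rotation plus an affine rotation field -/

/-- A goal specification: the pattern is placed by the exactly orthogonal rational matrix `M` (row-major, nine
entries) and corrected by the infinitesimal rotation `X ↦ X + ω(x) × X`, `ω` affine in the coordinates; the
certificate bounds `‖ω‖ ≤ θ` and the corrected displacements by `η − ε − aeps`. [folklore] -/
structure Goal where
  /-- rational orthogonal matrix, row-major -/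
  M : List ℚ
  /-- the three affine components of the rotation field -/
  om : List QPoly
  /-- bound on `‖ω‖` -/
  theta : ℚ
  /-- budget paid for the Rodrigues remainder, `≥ (θ²/2 + θ³/4)(1 + aeps)` -/
  eps : ℚ

namespace Goal

variable (P : ShellSpec) (g : Goal)

/-- Component `a` of the rotation field (junk `0`). [folklore] -/
def omP (a : ℕ) : QPoly := g.om.getD a (const 0)

/-- The placed anchor `q_k = M · anchor_k`. [folklore] -/
def q (k : ℕ) : ℚ × ℚ × ℚ := rotQ g.M (P.anchor k)

/-- Coordinate `a` of a rational point. [folklore] -/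
def coord (a : ℚ × ℚ × ℚ) (i : ℕ) : ℚ := if i = 0 then a.1 else if i = 1 then a.2.1 else a.2.2

/-- Component `a` of `ω × q_k` as an affine polynomial. [folklore] -/
def crossP (k a : ℕ) : QPoly :=
  let c := g.q P k
  if a = 0 then add (smul (coord c 2) (g.omP 1)) (smul (-coord c 1) (g.omP 2))
  else if a = 1 then add (smul (coord c 0) (g.omP 2)) (smul (-coord c 2) (g.omP 0))
  else add (smul (coord c 1) (g.omP 0)) (smul (-coord c 0) (g.omP 1))

/-- Component `a` of the corrected displacement `x_k − q_k − ω × q_k` (affine). [folklore] -/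
def dispP (k a : ℕ) : QPoly := sub (sub (var (3 * k + a)) (const (coord (g.q P k) a))) (g.crossP P k a)

/-- The goal polynomial of point `k`: `(η − ε − aeps)² − ‖x_k − q_k − ω × q_k‖²`. [folklore] -/
def closeP (k : ℕ) : QPoly :=
  sub (const ((P.eta - g.eps - P.aeps) ^ 2))
    (add (sqAff (g.dispP P k 0)) (add (sqAff (g.dispP P k 1)) (sqAff (g.dispP P k 2))))

/-- The goal polynomial `θ² − ‖ω‖²`. [folklore] -/
def thetaP : QPoly :=
  sub (const (g.theta ^ 2)) (add (sqAff (g.omP 0)) (add (sqAff (g.omP 1)) (sqAff (g.omP 2))))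

/-- Well-formedness: three affine field components, `M` orthogonal, `0 ≤ θ`, the Rodrigues budget
`(θ²/2 + θ³/4)(1 + aeps) ≤ ε`, and `0 ≤ η − ε − aeps`. [folklore] -/
def ok : Bool :=
  decide (g.om.length = 3) && g.om.all isAff && matOrthoB g.M && decide (0 ≤ g.theta) &&
    decide ((g.theta ^ 2 / 2 + g.theta ^ 3 / 4) * (1 + P.aeps) ≤ g.eps) && decide (0 ≤ P.eta - g.eps - P.aeps)

/-- **The goal polynomials** of a specification (`none` if ill formed): `θ² − ‖ω‖²` first, then the `n`
closeness polynomials. [folklore] -/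
def gp : Option (List QPoly) :=
  if g.ok P then some (g.thetaP :: (List.range P.n).map (g.closeP P)) else none

/-! ### Soundness of the goal polynomials -/

/-- The rotation field at `x`, as a vector. [folklore] -/
def omV (x : ℕ → ℝ) : E3 := !₂[(g.omP 0).eval x, (g.omP 1).eval x, (g.omP 2).eval x]

/-- Coordinates of `omV`. [folklore] -/
@[simp] theorem omV_apply_zero (x : ℕ → ℝ) : g.omV x 0 = (g.omP 0).eval x := rfl
/-- Coordinates of `omV`. [folklore] -/
@[simp] theorem omV_apply_one (x : ℕ → ℝ) : g.omV x 1 = (g.omP 1).eval x := rfl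
/-- Coordinates of `omV`. [folklore] -/
@[simp] theorem omV_apply_two (x : ℕ → ℝ) : g.omV x 2 = (g.omP 2).eval x := rfl

/-- `omP a` is affine when the specification is well formed. [folklore] -/
theorem isAff_omP (hok : g.ok P = true) (a : ℕ) : (g.omP a).isAff = true := by
  simp only [ok, Bool.and_eq_true, decide_eq_true_eq, List.all_eq_true] at hok
  unfold omP
  rw [List.getD_eq_getElem?_getD]
  cases h : g.om[a]? with
  | none => rfl
  | some p => exact hok.1.1.1.1.2 p (List.mem_of_getElem? h)

/-- `smul`, `add`, `var`, `const` preserve / have affinity (bookkeeping). [folklore] -/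
theorem isAff_lemmas :
    (∀ (a : ℚ) (p : QPoly), p.isAff = true → (smul a p).isAff = true) ∧
    (∀ p r : QPoly, p.isAff = true → r.isAff = true → (add p r).isAff = true) ∧
    (∀ i : ℕ, (var i).isAff = true) ∧ (∀ c : ℚ, (const c).isAff = true) := by
  refine ⟨fun a p hp => ?_, fun p r hp hr => ?_, fun i => rfl, fun c => rfl⟩
  · simp only [isAff, List.isEmpty_iff] at hp ⊢; simp [smul, hp]
  · simp only [isAff, List.isEmpty_iff] at hp hr ⊢; simp [add, hp, hr]

/-- `dispP` is affine when the specification is well formed. [folklore] -/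
theorem isAff_dispP (hok : g.ok P = true) (k a : ℕ) : (g.dispP P k a).isAff = true := by
  obtain ⟨hs, ha, hv, hc⟩ := isAff_lemmas
  have hsub : ∀ p r : QPoly, p.isAff = true → r.isAff = true → (sub p r).isAff = true :=
    fun p r hp hr => ha _ _ hp (hs _ _ hr)
  have hcr : (g.crossP P k a).isAff = true := by
    unfold crossP
    split_ifs <;> exact ha _ _ (hs _ _ (g.isAff_omP P hok _)) (hs _ _ (g.isAff_omP P hok _))
  exact hsub _ _ (hsub _ _ (hv _) (hc _)) hcr

/-- The value of `crossP k a` is component `a` of `ω × q_k`. [folklore] -/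
theorem eval_crossP (x : ℕ → ℝ) (k : ℕ) (a : Fin 3) :
    (g.crossP P k a).eval x = Literature.Analysis.FluidPDE.cross (g.omV x) (qpt (g.q P k)) a := by
  fin_cases a <;>
    simp [Literature.Analysis.FluidPDE.cross, cross_apply, crossP, coord, qpt] <;> ring

/-- The value of `dispP k a` is component `a` of `t k − q_k − ω × q_k`. [folklore] -/
theorem eval_dispP (t : Fin P.n → E3) (k : Fin P.n) (a : Fin 3) :
    (g.dispP P k a).eval (flat t) =
      (t k - qpt (g.q P k) - Literature.Analysis.FluidPDE.cross (g.omV (flat t)) (qpt (g.q P k))) a := by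
  rw [dispP, eval_sub, eval_sub, eval_var, eval_const, eval_crossP, PiLp.sub_apply, PiLp.sub_apply,
    flat_apply t k a]
  congr 2
  fin_cases a <;> simp [coord, qpt]

/-- From `‖v‖² ≤ c²` and `0 ≤ c` to `‖v‖ ≤ c`. [folklore] -/
theorem norm_le_of_sq_le {v : E3} {c : ℝ} (hc : 0 ≤ c) (h : ‖v‖ ^ 2 ≤ c ^ 2) : ‖v‖ ≤ c :=
  (pow_le_pow_iff_left₀ (norm_nonneg v) hc two_ne_zero).1 h

/-- **Soundness of the goal polynomials.**  If the goal polynomials of a well-formed specification are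
nonnegative at `flat t`, then `‖ω‖ ≤ θ` and every corrected displacement is at most `η − ε − aeps`. [folklore] -/
theorem goal_sound {qs : List QPoly} (hgp : g.gp P = some qs) (t : Fin P.n → E3)
    (hqs : ∀ p ∈ qs, 0 ≤ p.eval (flat t)) :
    g.ok P = true ∧ ‖g.omV (flat t)‖ ≤ g.theta ∧
      ∀ k : Fin P.n, ‖t k - qpt (g.q P k) - Literature.Analysis.FluidPDE.cross (g.omV (flat t)) (qpt (g.q P k))‖ ≤
        (P.eta : ℝ) - g.eps - P.aeps := by
  unfold gp at hgp
  split_ifs at hgp with hok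
  cases hgp
  have hok' := hok
  simp only [ok, Bool.and_eq_true, decide_eq_true_eq] at hok'
  obtain ⟨⟨⟨-, hth⟩, -⟩, hη⟩ := hok'
  have hth' : (0 : ℝ) ≤ g.theta := by exact_mod_cast hth
  have hη' : (0 : ℝ) ≤ P.eta - g.eps - P.aeps := by exact_mod_cast hη
  refine ⟨hok, ?_, fun k => ?_⟩
  · have h0 := hqs _ List.mem_cons_self
    rw [thetaP, eval_sub, eval_const, eval_add, eval_add, eval_sqAff _ (g.isAff_omP P hok 0),
      eval_sqAff _ (g.isAff_omP P hok 1), eval_sqAff _ (g.isAff_omP P hok 2)] at h0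
    refine norm_le_of_sq_le hth' ?_
    rw [norm_sq_fin3, omV_apply_zero, omV_apply_one, omV_apply_two]
    push_cast at h0
    linarith
  · have hmem : g.closeP P k ∈ g.thetaP :: (List.range P.n).map (g.closeP P) :=
      List.mem_cons_of_mem _ (List.mem_map.2 ⟨k, List.mem_range.2 k.2, rfl⟩)
    have h0 := hqs _ hmem
    rw [closeP, eval_sub, eval_const, eval_add, eval_add, eval_sqAff _ (g.isAff_dispP P hok k 0),
      eval_sqAff _ (g.isAff_dispP P hok k 1), eval_sqAff _ (g.isAff_dispP P hok k 2)] at h0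
    have e0 := g.eval_dispP P t k 0
    have e1 := g.eval_dispP P t k 1
    have e2 := g.eval_dispP P t k 2
    simp only [Fin.val_zero, Fin.val_one, Fin.val_two] at e0 e1 e2
    refine norm_le_of_sq_le hη' ?_
    rw [norm_sq_fin3, ← e0, ← e1, ← e2]
    push_cast at h0
    linarith

end Goal

/-! ### Dyadic goal specifications (appended 2026-08-17)

Certificates are shipped as text with DYADIC rationals (`QuadCertText.lean`), but an exactly orthogonal rational matrix
is never dyadic.  A `DGoal` therefore carries the PLACED anchors `q_k` themselves (dyadic points) together with the
integer quaternion whose exact matrix `quatMat` they approximate to within `qeps`, and the goal constant `cst`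
(`≤ (η − ε − aeps − qeps)²`) explicitly; `okD` re-verifies everything in `ℚ`.  `DGoal.read` is its text decoder. -/

/-- Squared distance of rational points. [folklore] -/
def sqDistQ (a b : ℚ × ℚ × ℚ) : ℚ := (a.1 - b.1) ^ 2 + (a.2.1 - b.2.1) ^ 2 + (a.2.2 - b.2.2) ^ 2

/-- `dist (qpt a) (qpt b)² = sqDistQ a b`. [folklore] -/
theorem dist_qpt_sq (a b : ℚ × ℚ × ℚ) : dist (qpt a) (qpt b) ^ 2 = (sqDistQ a b : ℝ) := by
  rw [dist_sq_fin3]; simp [sqDistQ, qpt]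

/-- A dyadic goal specification: integer quaternion `(a, b, c, d, s)` (matrix `quatMat a b c d s`), the placed
anchors `pts` (`≈ quatMat · anchor`), the affine rotation field `om`, and rationals `θ`, `ε`, `cst`, `qeps`. [folklore] -/
structure DGoal where
  /-- integer quaternion and sign -/
  quat : ℤ × ℤ × ℤ × ℤ × ℤ
  /-- placed anchors `q_k` -/
  pts : List (ℚ × ℚ × ℚ)
  /-- the three affine components of the rotation field -/
  om : List QPoly
  /-- bound on `‖ω‖` -/
  theta : ℚ
  /-- Rodrigues budget -/
  eps : ℚ
  /-- the goal constant, `≤ (η − ε − aeps − qeps)²` -/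
  cst : ℚ
  /-- placement accuracy `‖q_k − quatMat · anchor_k‖ ≤ qeps` -/
  qeps : ℚ

namespace DGoal

variable (P : ShellSpec) (g : DGoal)

/-- The exact matrix of the quaternion. [folklore] -/
def M : List ℚ := quatMat g.quat.1 g.quat.2.1 g.quat.2.2.1 g.quat.2.2.2.1 g.quat.2.2.2.2

/-- Placed anchor `k` (junk `0`). [folklore] -/
def q (k : ℕ) : ℚ × ℚ × ℚ := g.pts.getD k (0, 0, 0)

/-- Component `a` of the rotation field (junk `0`). [folklore] -/
def omP (a : ℕ) : QPoly := g.om.getD a (const 0)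

/-- Component `a` of `ω × q_k` as an affine polynomial. [folklore] -/
def crossP (k a : ℕ) : QPoly :=
  let c := g.q k
  if a = 0 then add (smul (Goal.coord c 2) (g.omP 1)) (smul (-Goal.coord c 1) (g.omP 2))
  else if a = 1 then add (smul (Goal.coord c 0) (g.omP 2)) (smul (-Goal.coord c 2) (g.omP 0))
  else add (smul (Goal.coord c 1) (g.omP 0)) (smul (-Goal.coord c 0) (g.omP 1))

/-- Component `a` of `x_k − q_k − ω × q_k` (affine). [folklore] -/
def dispP (k a : ℕ) : QPoly := sub (sub (var (3 * k + a)) (const (Goal.coord (g.q k) a))) (g.crossP k a)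

/-- Goal polynomial of point `k`: `cst − ‖x_k − q_k − ω × q_k‖²`. [folklore] -/
def closeP (k : ℕ) : QPoly :=
  sub (const g.cst) (add (sqAff (g.dispP k 0)) (add (sqAff (g.dispP k 1)) (sqAff (g.dispP k 2))))

/-- Goal polynomial `θ² − ‖ω‖²`. [folklore] -/
def thetaP : QPoly :=
  sub (const (g.theta ^ 2)) (add (sqAff (g.omP 0)) (add (sqAff (g.omP 1)) (sqAff (g.omP 2))))

/-- The residual budget `η − ε − aeps − qeps`. [folklore] -/
def budget : ℚ := P.eta - g.eps - P.aeps - g.qeps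

/-- Well-formedness, all decided in `ℚ`. [folklore] -/
def ok : Bool :=
  decide (g.om.length = 3) && g.om.all isAff && matOrthoB g.M && decide (g.pts.length = P.n) &&
    decide (0 ≤ g.qeps) && decide (0 ≤ g.theta) && decide (0 ≤ g.cst) &&
    (List.range P.n).all (fun k => decide (sqDistQ (g.q k) (rotQ g.M (P.anchor k)) ≤ g.qeps ^ 2)) &&
    decide ((g.theta ^ 2 / 2 + g.theta ^ 3 / 4) * (1 + P.aeps + g.qeps) ≤ g.eps) &&
    decide (0 ≤ g.budget P) && decide (g.cst ≤ g.budget P ^ 2)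

/-- **Goal polynomials** of a dyadic specification. [folklore] -/
def gp : Option (List QPoly) :=
  if g.ok P then some (g.thetaP :: (List.range P.n).map g.closeP) else none

/-- The rotation field at `x`. [folklore] -/
def omV (x : ℕ → ℝ) : E3 := !₂[(g.omP 0).eval x, (g.omP 1).eval x, (g.omP 2).eval x]

/-- Coordinates of `omV`. [folklore] -/
@[simp] theorem omV_apply_zero (x : ℕ → ℝ) : g.omV x 0 = (g.omP 0).eval x := rfl
/-- Coordinates of `omV`. [folklore] -/
@[simp] theorem omV_apply_one (x : ℕ → ℝ) : g.omV x 1 = (g.omP 1).eval x := rfl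
/-- Coordinates of `omV`. [folklore] -/
@[simp] theorem omV_apply_two (x : ℕ → ℝ) : g.omV x 2 = (g.omP 2).eval x := rfl

/-- `omP a` is affine when well formed. [folklore] -/
theorem isAff_omP (hok : g.ok P = true) (a : ℕ) : (g.omP a).isAff = true := by
  simp only [ok, Bool.and_eq_true, decide_eq_true_eq, List.all_eq_true] at hok
  unfold omP
  rw [List.getD_eq_getElem?_getD]
  cases h : g.om[a]? with
  | none => rfl
  | some p => exact hok.1.1.1.1.1.1.1.1.1.2 p (List.mem_of_getElem? h)

/-- `dispP` is affine when well formed. [folklore] -/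
theorem isAff_dispP (hok : g.ok P = true) (k a : ℕ) : (g.dispP k a).isAff = true := by
  obtain ⟨hs, ha, hv, hc⟩ := Goal.isAff_lemmas
  have hsub : ∀ p r : QPoly, p.isAff = true → r.isAff = true → (sub p r).isAff = true :=
    fun p r hp hr => ha _ _ hp (hs _ _ hr)
  have hcr : (g.crossP k a).isAff = true := by
    unfold crossP
    split_ifs <;> exact ha _ _ (hs _ _ (g.isAff_omP P hok _)) (hs _ _ (g.isAff_omP P hok _))
  exact hsub _ _ (hsub _ _ (hv _) (hc _)) hcr

/-- The value of `crossP k a` is component `a` of `ω × q_k`. [folklore] -/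
theorem eval_crossP (x : ℕ → ℝ) (k : ℕ) (a : Fin 3) :
    (g.crossP k a).eval x = Literature.Analysis.FluidPDE.cross (g.omV x) (qpt (g.q k)) a := by
  fin_cases a <;>
    simp [Literature.Analysis.FluidPDE.cross, cross_apply, crossP, Goal.coord, qpt] <;> ring

/-- The value of `dispP k a` is component `a` of `t k − q_k − ω × q_k`. [folklore] -/
theorem eval_dispP (t : Fin P.n → E3) (k : Fin P.n) (a : Fin 3) :
    (g.dispP k a).eval (flat t) =
      (t k - qpt (g.q k) - Literature.Analysis.FluidPDE.cross (g.omV (flat t)) (qpt (g.q k))) a := by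
  rw [dispP, eval_sub, eval_sub, eval_var, eval_const, eval_crossP, PiLp.sub_apply, PiLp.sub_apply,
    flat_apply t k a]
  congr 2
  fin_cases a <;> simp [Goal.coord, qpt]

/-- **Soundness of the dyadic goal polynomials**: well-formedness, `‖ω‖ ≤ θ`, every corrected displacement at most
`η − ε − aeps − qeps`, and every placed anchor within `qeps` of the exact image `quatMat · anchor`. [folklore] -/
theorem goal_sound {qs : List QPoly} (hgp : g.gp P = some qs) (t : Fin P.n → E3)
    (hqs : ∀ p ∈ qs, 0 ≤ p.eval (flat t)) :
    g.ok P = true ∧ ‖g.omV (flat t)‖ ≤ g.theta ∧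
      (∀ k : Fin P.n, ‖t k - qpt (g.q k) - Literature.Analysis.FluidPDE.cross (g.omV (flat t)) (qpt (g.q k))‖ ≤
        (g.budget P : ℝ)) ∧
      ∀ k : Fin P.n, dist (qpt (g.q k)) (qpt (rotQ g.M (P.anchor k))) ≤ g.qeps := by
  unfold gp at hgp
  split_ifs at hgp with hok
  cases hgp
  have hok' := hok
  simp only [ok, Bool.and_eq_true, decide_eq_true_eq, List.all_eq_true, List.mem_range] at hok'
  obtain ⟨⟨⟨⟨⟨⟨⟨-, hqe⟩, hth⟩, hcst⟩, hpts⟩, -⟩, hbud⟩, hcb⟩ := hok'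
  have hth' : (0 : ℝ) ≤ g.theta := by exact_mod_cast hth
  have hbud' : (0 : ℝ) ≤ g.budget P := by exact_mod_cast hbud
  have hqe' : (0 : ℝ) ≤ g.qeps := by exact_mod_cast hqe
  refine ⟨hok, ?_, fun k => ?_, fun k => ?_⟩
  · have h0 := hqs _ List.mem_cons_self
    rw [thetaP, eval_sub, eval_const, eval_add, eval_add, eval_sqAff _ (g.isAff_omP P hok 0),
      eval_sqAff _ (g.isAff_omP P hok 1), eval_sqAff _ (g.isAff_omP P hok 2)] at h0
    refine Goal.norm_le_of_sq_le hth' ?_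
    rw [norm_sq_fin3, omV_apply_zero, omV_apply_one, omV_apply_two]
    push_cast at h0
    linarith
  · have hmem : g.closeP k ∈ g.thetaP :: (List.range P.n).map g.closeP :=
      List.mem_cons_of_mem _ (List.mem_map.2 ⟨k, List.mem_range.2 k.2, rfl⟩)
    have h0 := hqs _ hmem
    rw [closeP, eval_sub, eval_const, eval_add, eval_add, eval_sqAff _ (g.isAff_dispP P hok k 0),
      eval_sqAff _ (g.isAff_dispP P hok k 1), eval_sqAff _ (g.isAff_dispP P hok k 2)] at h0
    have e0 := g.eval_dispP P t k 0
    have e1 := g.eval_dispP P t k 1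
    have e2 := g.eval_dispP P t k 2
    simp only [Fin.val_zero, Fin.val_one, Fin.val_two] at e0 e1 e2
    refine Goal.norm_le_of_sq_le hbud' ?_
    have hc : (g.cst : ℝ) ≤ (g.budget P : ℝ) ^ 2 := by exact_mod_cast hcb
    rw [norm_sq_fin3, ← e0, ← e1, ← e2]
    linarith
  · have h := hpts k k.2
    have hsq : dist (qpt (g.q k)) (qpt (rotQ g.M (P.anchor k))) ^ 2 ≤ (g.qeps : ℝ) ^ 2 := by
      rw [dist_qpt_sq]; exact_mod_cast h
    exact (pow_le_pow_iff_left₀ dist_nonneg hqe' two_ne_zero).1 hsq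

/-! ### Text decoder of dyadic goal specifications

`quat:5 ints, n, (q_k: 3 rationals)^n, ω₀ ω₁ ω₂ : poly, θ ε cst qeps : rationals` (rationals and polynomials in the
format of `QuadCertText.lean`). -/

open QuadCert.Text in
/-- Read `n` dyadic points. [folklore] -/
def readPts (ts : Array ℤ) : ℕ → ℕ → List (ℚ × ℚ × ℚ) × ℕ
  | 0, i => ([], i)
  | n + 1, i =>
    let r := readPts ts n (i + 6)
    ((ratAt ts i, ratAt ts (i + 2), ratAt ts (i + 4)) :: r.1, r.2)

open QuadCert.Text in
/-- **Decode** a dyadic goal specification at position `i`. [folklore] -/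
def read (ts : Array ℤ) (i : ℕ) : Option (DGoal × ℕ) :=
  let quat := (intAt ts i, intAt ts (i + 1), intAt ts (i + 2), intAt ts (i + 3), intAt ts (i + 4))
  let pts := readPts ts (natAt ts (i + 5)) (i + 6)
  let o0 := readPoly ts pts.2
  let o1 := readPoly ts o0.2
  let o2 := readPoly ts o1.2
  let j := o2.2
  some ({ quat := quat, pts := pts.1, om := [o0.1, o1.1, o2.1], theta := ratAt ts j, eps := ratAt ts (j + 2),
          cst := ratAt ts (j + 4), qeps := ratAt ts (j + 6) }, j + 8)

end DGoal

end ShellQuadCert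

end Literature.Geometry.DiscreteGeometry

end
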